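import Literature.Computability.Cryptography.QubitRegister
import HarnessLib

/-!
# The Pauli `X` gate is unitary — discharged fact

Proof of the named fact `Literature.Computability.Cryptography.pauliX_mem_unitaryGroup` stated in
`Literature.Computability.Cryptography.QubitRegister` (kept in a sibling file so that the
statement file stays a definitions/named-facts file, and separate from the shared
`QubitRegisterProofs` so that independent discharges do not overwrite each other):

* `star_pauliX`: `X† = X` (the Pauli `X` gate is Hermitian);
* `pauliX_mul_pauliX`: `X² = I`;
* `pauliX_mem_unitaryGroup_holds` discharges `pauliX_mem_unitaryGroup`: the NOT gate
  `X = [[0, 1], [1, 0]]`, as the matrix `pauliX : Matrix (QReg 1) (QReg 1) ℂ` indexed by one-qubit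
  basis labels `QReg 1 = (Fin 1 → Bool)`, lies in the unitary group, since `X X† = X X = I`.

The only non-trivial step is the entry sum in `(X X) x y = ∑_z X x z · X z y`: a one-qubit label is
determined by its single bit, so the sum over `QReg 1` is transported to a two-term sum over
`Bool` along `Equiv.funUnique (Fin 1) Bool`, and the four cases `x₀, y₀ ∈ {false, true}` are
closed by `simp`.

## References

* M. A. Nielsen, I. L. Chuang, *Quantum Computation and Quantum Information*, 10th anniversary
  ed., CUP 2010 [NielsenChuang2010]: §2.1.6, Exercise 2.19 ("Pauli matrices: Hermitian and
  unitary — Show that the Pauli matrices are Hermitian and unitary"), book p. 71; Exercise 2.41,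
  eq. (2.76) (`σᵢ² = I`), book p. 78; §1.3.1 (the `X` gate as the quantum NOT gate).
-/

namespace Literature.Computability.Cryptography

open Matrix

/-- Entries of the Pauli `X` gate: `X x y = [x₀ ≠ y₀]` (definitional unfolding of `pauliX`).
[folklore] -/
theorem pauliX_apply (x y : QReg 1) : pauliX x y = if x 0 = y 0 then 0 else 1 := rfl

/-- The Pauli `X` gate is Hermitian, `X† = X`: its entries are the real numbers `0, 1` and the
matrix is symmetric. (Nielsen–Chuang §2.1.6, Exercise 2.19 "Pauli matrices: Hermitian and
unitary", book p. 71.) [cite: NielsenChuang2010, §2.1.6 Exercise 2.19, p. 71] -/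
theorem star_pauliX : star pauliX = pauliX := by
  ext x y
  rw [Matrix.star_apply, pauliX_apply, pauliX_apply]
  by_cases h : x 0 = y 0
  · rw [if_pos h, if_pos h.symm, star_zero]
  · rw [if_neg h, if_neg (Ne.symm h), star_one]

/-- The Pauli `X` gate is an involution, `X² = I` (Nielsen–Chuang Exercise 2.41, eq. (2.76)
`σᵢ² = I`, book p. 78). The sum over the intermediate register `QReg 1 = (Fin 1 → Bool)` is
transported to a sum over `Bool` along `Equiv.funUnique`.
[cite: NielsenChuang2010, Exercise 2.41 eq. (2.76), p. 78] -/
theorem pauliX_mul_pauliX : pauliX * pauliX = 1 := by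
  ext x y
  rw [Matrix.mul_apply, Fintype.sum_equiv (Equiv.funUnique (Fin 1) Bool) _
    (fun b => pauliX x (fun _ => b) * pauliX (fun _ => b) y) (fun z => ?_)]
  · rw [Fintype.sum_bool, pauliX_apply, pauliX_apply, pauliX_apply, pauliX_apply, Matrix.one_apply]
    -- a one-qubit label is determined by its single bit
    have hxy : x = y ↔ x 0 = y 0 := by
      constructor
      · rintro rfl; rfl
      · intro h; funext i; rw [Subsingleton.elim i 0]; exact h
    rcases hx : x 0 with _ | _ <;> rcases hy : y 0 with _ | _ <;> simp [hxy, hx, hy]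
  · have hz : (fun _ : Fin 1 => z default) = z := funext fun i => congrArg z (Subsingleton.elim _ _)
    simp only [Equiv.funUnique_apply, hz]

/-- **Discharge of `pauliX_mem_unitaryGroup`.** The Pauli `X` (NOT) gate is unitary:
`X X† = X X = I` by `star_pauliX` and `pauliX_mul_pauliX`. This is Nielsen–Chuang, *Quantum
Computation and Quantum Information* (10th anniversary ed., 2010), §2.1.6, Exercise 2.19 ("Show
that the Pauli matrices are Hermitian and unitary"), book p. 71; the fact's own docstring locator
"§2.1.5" points at the same chapter (the exercise sits in §2.1.6, *Adjoints and Hermitian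
operators*). [cite: NielsenChuang2010, §2.1.6 Exercise 2.19, p. 71] -/
theorem pauliX_mem_unitaryGroup_holds : pauliX_mem_unitaryGroup := by
  unfold pauliX_mem_unitaryGroup
  rw [Matrix.mem_unitaryGroup_iff, star_pauliX, pauliX_mul_pauliX]

end Literature.Computability.Cryptography
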